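import Summits.CriticalPhenomena.PercolationContinuityZ3.Theorems.PercNearOneGluingNoHeavyQuantTwoMidCellRates
import HarnessLib

/-!
# QUANT lane R8, T-DEC: the WIDE CELL of `LightSliceWide` — piece C (the cheap piece: the low `P2 = p + l′` against the mids
# `M2 = m + l′`, `PH = p + h′`) (census-2 g60)

builds on p205010 (kernel theorem, internal audit signed; external expert review pending)

Support file (`--supports stmt-CriticalPhenomena-4575`), QUANT lane seat prim-quant-census-2 (gen 60), rung R8 of `…/quant/LADDER.md`.
Memo `run/shared/lean/prim/quant/prim-quant-census-2-g60/WIDE-G60.md`.  Theorems only, standard axioms, no sorries, no definitions.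

SETTING (memo §1–§2).  In the wide residue `LawDec.LightSliceWide` (census-2 g59; top giant `m + h′`, the upper cross cell `m + l′` a MID,
`T ≤ 2(m + l′)`, aspect `a = (m−p)/(h′−l′) < 1/4`) the light slice is the eight-term law with lows `P1 = p+l`, `P2 = p+l′` (and `M1 = m+l` when
it is a conv-low), mids `M2 = m+l′` (mass `γ m_C`), `PH = p+h′` (mass `(1−γ)m_C c₂`) (and `PG = p+h`, `M1` when they are mids), giants
`m+h′`, `m+h` (and `p+h` when `j+1 ≤ p+h`).  Reduced variables (unit `B′ = h′ − l′`): floor `x`, light pair rate `r` (`γ = x² + (1−x)r`), cheap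
rate `c < x`, `a`, with `ρ_P := c + ra ≤ 2a` (the mid condition); the pair `P2 → PH` has rate `ρ_P` (light or heavy), `P2 → M2` has rate `ρ_P/a`
(compatible iff `ρ_P < a`).  THE STRUCTURE FOUND (memo §3): the PURE SPLIT suffices — every low is priced only against the mids of ITS OWN
piece (no cross pairs), the two pieces share the giant pool; piece C leaves at most `γ m_C/(1+x−c)` for the giants:
* `key_r` — `(1+x−r)r ≤ γ` (`= γ − (x−r)²`), whence `(1−γ)ra ≤ (1−x)γa` (`key_ra`);
* `restC_le` — `R_C := (1−γ) − (1−γ)c₂/U_{P2H} − [ρ_P < a]·γ/U_{P2M} ≤ γ/(1+x−c)` (four sub-cases light/heavy, by hand: the light identity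
  `1 − c₂/U_ℓ(ρ_P) = ra/((x²+(1−x)ρ_P)(1+x−c))` and the heavy identity `(1−γ)(1 − c₂(1−ρ_P)/ρ_P) = (1+x−r)(ρ_P − x² − (1−x)c)/((1+x−c)ρ_P)`);
* `restC_le_theta` — with the price factor of a compatible heavy pair `P1 → M1` of the expensive piece, `θ = a/(w + ra) > 1` (`w = ρ_e ε ≥ x`):
  `max(R_C, 0) + γ(x−c)θ/(1+x−c) ≤ γ`;
(The pricing wrapper `WideCell.pieceC` turning these into the dual inequality is in `…QuantWideCellReal`.)

[this work].  The gluing rows served [cite: KozmaNitzan2024, Conjecture 3 (p. 15)]; product measure [cite: Grimmett1999, §1.3 p. 10].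
-/

noncomputable section

namespace Summit.CriticalPhenomena.PercolationContinuityZ3.Theorems

namespace Quant

namespace LawDec

namespace WideCell

/-- light usage `U_ℓ(ρ) = (x² + (1−x)ρ)/((1−x)(1+x−ρ))` -/
local notation3 "UL[" x ", " ρ "]" => ((x : ℝ) ^ 2 + (1 - x) * ρ) / ((1 - x) * (1 + x - ρ))

/-! ### two little facts on the light pair -/

/-- `(1 + x − r)·r ≤ γ = x² + (1−x)r` (the difference is `(x − r)²`). [this work] -/
theorem key_r (x r : ℝ) : (1 + x - r) * r ≤ x ^ 2 + (1 - x) * r := by nlinarith [sq_nonneg (x - r)]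

/-- `(1 − γ)·r·a ≤ (1 − x)·γ·a`. [this work] -/
theorem key_ra (x r a γ : ℝ) (hγ : γ = x ^ 2 + (1 - x) * r) (hx1 : x < 1) (ha0 : 0 ≤ a) :
    (1 - γ) * (r * a) ≤ (1 - x) * γ * a := by
  have e : (1 - γ) * (r * a) = ((1 - x) * a) * ((1 + x - r) * r) := by rw [hγ]; ring
  rw [e]
  have := mul_le_mul_of_nonneg_left (key_r x r) (mul_nonneg (by linarith : (0:ℝ) ≤ 1 - x) ha0)
  rw [← hγ] at this
  linarith

/-! ### the leftover of piece C: four sub-cases -/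

/-- light `P2 → PH`: the identity `1 − c₂/U_ℓ(ρ_P) = ra/((x² + (1−x)ρ_P)(1+x−c))`. [this work] -/
theorem one_sub_light (x r c a ρP c₂ UH : ℝ) (hx0 : 0 < x) (hx1 : x < 1) (hcx : c < x) (hρP : ρP = c + r * a)
    (hρP0 : 0 ≤ ρP) (hρPx : ρP ≤ x) (hc₂ : c₂ = UL[x, c]) (hUH : UH = UL[x, ρP]) :
    1 - c₂ / UH = r * a / ((x ^ 2 + (1 - x) * ρP) * (1 + x - c)) := by
  have h1x : (1:ℝ) - x ≠ 0 := by linarith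
  have d1 : (1:ℝ) + x - c ≠ 0 := by linarith
  have d2 : (1:ℝ) + x - ρP ≠ 0 := by linarith
  have gP : x ^ 2 + (1 - x) * ρP ≠ 0 := by nlinarith
  rw [hc₂, hUH, div_div_div_eq, hρP]
  rw [hρP] at gP d2
  field_simp
  ring

/-- (light `P2→PH`, `P2→M2` incompatible) `R_C ≤ γ/(1+x−c)`. [this work] -/
theorem restC_ll (x r c a γ ρP c₂ UH : ℝ) (hγ : γ = x ^ 2 + (1 - x) * r) (hx0 : 0 < x) (hx1 : x < 1) (hr0 : 0 ≤ r)
    (hcx : c < x) (ha0 : 0 < a) (hρP : ρP = c + r * a) (hρPx : ρP ≤ x) (hinc : a ≤ ρP)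
    (hc₂ : c₂ = UL[x, c]) (hUH : UH = UL[x, ρP]) :
    (1 - γ) - (1 - γ) * c₂ / UH ≤ γ / (1 + x - c) := by
  have hρP0 : 0 ≤ ρP := by rw [hρP]; nlinarith
  have hfr := one_sub_light x r c a ρP c₂ UH hx0 hx1 hcx hρP hρP0 hρPx hc₂ hUH
  have e : (1 - γ) - (1 - γ) * c₂ / UH = (1 - γ) * (1 - c₂ / UH) := by ring
  rw [e, hfr]
  have gP0 : 0 < x ^ 2 + (1 - x) * ρP := by nlinarith
  have hxc : 0 < 1 + x - c := by linarith
  rw [show (1 - γ) * (r * a / ((x ^ 2 + (1 - x) * ρP) * (1 + x - c))) = ((1 - γ) * (r * a) / (x ^ 2 + (1 - x) * ρP)) / (1 + x - c) by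
    field_simp]
  rw [div_le_div_iff_of_pos_right hxc, div_le_iff₀ gP0]
  have h1 := key_ra x r a γ hγ hx1 ha0.le
  have hγ0 : 0 ≤ γ := by rw [hγ]; nlinarith
  nlinarith [mul_le_mul_of_nonneg_left hinc (mul_nonneg (by linarith : (0:ℝ) ≤ 1 - x) hγ0)]

/-- (light `P2→PH`, compatible HEAVY `P2→M2`, `x ≤ ρ_P/a`) `R_C ≤ γ/(1+x−c)`. [this work] -/
theorem restC_lh (x r c a γ ρP c₂ UH UM : ℝ) (hγ : γ = x ^ 2 + (1 - x) * r) (hx0 : 0 < x) (hx1 : x < 1) (hr0 : 0 ≤ r)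
    (hcx : c < x) (ha0 : 0 < a) (hρP : ρP = c + r * a) (hρPx : ρP ≤ x) (hcomp : ρP < a) (hσ : x ≤ ρP / a)
    (hc₂ : c₂ = UL[x, c]) (hUH : UH = UL[x, ρP]) (hUM : UM = (ρP / a) / (1 - ρP / a)) :
    (1 - γ) - (1 - γ) * c₂ / UH - γ / UM ≤ γ / (1 + x - c) := by
  have hρP0 : 0 < ρP := by
    have : 0 < ρP / a := lt_of_lt_of_le hx0 hσ
    have := mul_pos this ha0
    rwa [div_mul_cancel₀ _ ha0.ne'] at this
  have hfr := one_sub_light x r c a ρP c₂ UH hx0 hx1 hcx hρP hρP0.le hρPx hc₂ hUH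
  have hUMv : γ / UM = γ * (a - ρP) / ρP := by
    rw [hUM]; field_simp
  have e : (1 - γ) - (1 - γ) * c₂ / UH - γ / UM = (1 - γ) * (1 - c₂ / UH) - γ / UM := by ring
  rw [e, hfr, hUMv]
  have gP0 : 0 < x ^ 2 + (1 - x) * ρP := by nlinarith
  have hxc : 1 ≤ 1 + x - c := by linarith
  have hγ0 : 0 ≤ γ := by rw [hγ]; nlinarith
  have h1 := key_ra x r a γ hγ hx1 ha0.le
  -- but we need the sharper: LHS ≤ γ/(1+x−c). Use instead `(1−γ)ra/(γP(1+x−c)) ≤ ((1−x)γa/γP)/(1+x−c)` and `(a−ρP)/ρP ≥ (a−ρP)/(ρP (1+x−c))`.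
  have s1 : (1 - γ) * (r * a / ((x ^ 2 + (1 - x) * ρP) * (1 + x - c))) ≤ (γ * a / ρP) / (1 + x - c) := by
    rw [show (1 - γ) * (r * a / ((x ^ 2 + (1 - x) * ρP) * (1 + x - c)))
        = ((1 - γ) * (r * a) / (x ^ 2 + (1 - x) * ρP)) / (1 + x - c) by field_simp]
    refine div_le_div_of_nonneg_right ?_ (by linarith)
    rw [div_le_iff₀ gP0]
    have u1 : (1 - γ) * (r * a) ≤ (1 - x) * γ * a := h1
    have u2 : (1 - x) * γ * a ≤ γ * a / ρP * (x ^ 2 + (1 - x) * ρP) := by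
      rw [show γ * a / ρP * (x ^ 2 + (1 - x) * ρP) = γ * a * x ^ 2 / ρP + (1 - x) * γ * a by field_simp]
      have : 0 ≤ γ * a * x ^ 2 / ρP := div_nonneg (by positivity) hρP0.le
      linarith
    linarith
  have s2 : γ * (a - ρP) / ρP ≥ (γ * (a - ρP) / ρP) / (1 + x - c) := by
    refine div_le_self (div_nonneg (mul_nonneg hγ0 (by linarith)) hρP0.le) hxc
  have s3 : (γ * a / ρP) / (1 + x - c) - (γ * (a - ρP) / ρP) / (1 + x - c) = γ / (1 + x - c) := by
    field_simp; ring
  linarith [s1, s2, s3]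

/-- (light `P2→PH`, compatible LIGHT `P2→M2`, `ρ_P/a ≤ x`) `R_C ≤ 0`. [this work] -/
theorem restC_llight_nonpos (x r c a γ ρP c₂ UH UM : ℝ) (hγ : γ = x ^ 2 + (1 - x) * r) (hx0 : 0 < x) (hx1 : x < 1) (hr0 : 0 ≤ r)
    (hc0 : 0 ≤ c) (hcx : c < x) (ha0 : 0 < a) (ha1 : a ≤ 1) (hρP : ρP = c + r * a) (hρPx : ρP ≤ x) (hσx : ρP / a ≤ x)
    (hc₂ : c₂ = UL[x, c]) (hUH : UH = UL[x, ρP]) (hUM : UM = UL[x, ρP / a]) :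
    (1 - γ) - (1 - γ) * c₂ / UH - γ / UM ≤ 0 := by
  have hρP0 : 0 ≤ ρP := by rw [hρP]; nlinarith
  have hσ0 : 0 ≤ ρP / a := div_nonneg hρP0 ha0.le
  have hfr := one_sub_light x r c a ρP c₂ UH hx0 hx1 hcx hρP hρP0 hρPx hc₂ hUH
  have e : (1 - γ) - (1 - γ) * c₂ / UH - γ / UM = (1 - γ) * (1 - c₂ / UH) - γ / UM := by ring
  rw [e, hfr]
  have gP0 : 0 < x ^ 2 + (1 - x) * ρP := by nlinarith
  have gσ0 : 0 < x ^ 2 + (1 - x) * (ρP / a) := by nlinarith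
  have hγ0 : 0 ≤ γ := by rw [hγ]; nlinarith
  have h1 := key_ra x r a γ hγ hx1 ha0.le
  -- `(1−γ)ra/(γP(1+x−c)) ≤ (1−x)γa/γP`
  have t1 : (1 - γ) * (r * a / ((x ^ 2 + (1 - x) * ρP) * (1 + x - c))) ≤ (1 - x) * γ * a / (x ^ 2 + (1 - x) * ρP) := by
    rw [show (1 - γ) * (r * a / ((x ^ 2 + (1 - x) * ρP) * (1 + x - c)))
        = ((1 - γ) * (r * a) / (1 + x - c)) / (x ^ 2 + (1 - x) * ρP) by field_simp]
    refine div_le_div_of_nonneg_right ?_ gP0.le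
    rw [div_le_iff₀ (by linarith : (0:ℝ) < 1 + x - c)]
    have : 0 ≤ (1 - x) * γ * a := mul_nonneg (mul_nonneg (by linarith) hγ0) ha0.le
    nlinarith
  -- `γ/UM = γ(1−x)(1+x−σ)/(x²+(1−x)σ) ≥ γ(1−x)/(x²+(1−x)σ) ≥ (1−x)γ a/γP`
  have hUMv : γ / UM = γ * ((1 - x) * (1 + x - ρP / a)) / (x ^ 2 + (1 - x) * (ρP / a)) := by
    rw [hUM]; field_simp
  rw [hUMv]
  have t2 : γ * ((1 - x) * 1) / (x ^ 2 + (1 - x) * (ρP / a)) ≤ γ * ((1 - x) * (1 + x - ρP / a)) / (x ^ 2 + (1 - x) * (ρP / a)) := by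
    refine div_le_div_of_nonneg_right ?_ gσ0.le
    refine mul_le_mul_of_nonneg_left (mul_le_mul_of_nonneg_left (by linarith) (by linarith)) hγ0
  have t3 : (1 - x) * γ * a / (x ^ 2 + (1 - x) * ρP) ≤ γ * ((1 - x) * 1) / (x ^ 2 + (1 - x) * (ρP / a)) := by
    rw [mul_one, div_le_div_iff₀ gP0 gσ0]
    -- `(1−x)γa (x² + (1−x)σ) ≤ γ(1−x)(x² + (1−x)ρP)` ⟸ `a x² ≤ x²` (`aσ = ρP`)
    have e1 : (1 - x) * γ * a * (x ^ 2 + (1 - x) * (ρP / a)) = (1 - x) * γ * (a * x ^ 2 + (1 - x) * ρP) := by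
      field_simp
    rw [e1]
    have : a * x ^ 2 ≤ x ^ 2 := by nlinarith [sq_nonneg x]
    have h1x : 0 ≤ (1 - x) * γ := mul_nonneg (by linarith) hγ0
    nlinarith [mul_le_mul_of_nonneg_left this h1x]
  linarith

/-- heavy `P2 → PH` (`x ≤ ρ_P`): `(1−γ)(1 − c₂(1−ρ_P)/ρ_P) ≤ (1+x−r) r a/((1+x−c)ρ_P) ≤ γ a/((1+x−c)ρ_P)`. [this work] -/
theorem one_sub_heavy_le (x r c a γ ρP c₂ UH : ℝ) (hγ : γ = x ^ 2 + (1 - x) * r) (hx0 : 0 < x) (hx1 : x < 1)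
    (hrx : r < x) (hcx : c < x) (ha0 : 0 < a) (hρP : ρP = c + r * a) (hρPx : x ≤ ρP)
    (hc₂ : c₂ = UL[x, c]) (hUH : UH = ρP / (1 - ρP)) :
    (1 - γ) - (1 - γ) * c₂ / UH ≤ γ * a / ((1 + x - c) * ρP) := by
  have hρP0 : 0 < ρP := by linarith
  have h1x : (1:ℝ) - x ≠ 0 := by linarith
  have d1 : (0:ℝ) < 1 + x - c := by linarith
  -- the identity `(1−γ) − (1−γ)c₂(1−ρP)/ρP = (1+x−r)(ρP − x² − (1−x)c)/((1+x−c)ρP)`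
  have hid : (1 - γ) - (1 - γ) * c₂ / UH = (1 + x - r) * (ρP - x ^ 2 - (1 - x) * c) / ((1 + x - c) * ρP) := by
    rw [hUH, hc₂, hγ]
    field_simp
    ring
  rw [hid, div_le_div_iff_of_pos_right (mul_pos d1 hρP0)]
  -- `ρP − x² − (1−x)c = ra − x(x−c) ≤ ra` and `(1+x−r) ra ≤ γ a`
  have e1 : ρP - x ^ 2 - (1 - x) * c = r * a - x * (x - c) := by rw [hρP]; ring
  rw [e1]
  have k := key_r x r
  rw [← hγ] at k
  have hx_c : 0 ≤ x * (x - c) := by nlinarith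
  have h1xr : 0 ≤ 1 + x - r := by linarith
  nlinarith [mul_le_mul_of_nonneg_right k ha0.le, mul_nonneg h1xr hx_c]

/-- (heavy `P2→PH`, `P2→M2` incompatible) `R_C ≤ γ/(1+x−c)`. [this work] -/
theorem restC_hi (x r c a γ ρP c₂ UH : ℝ) (hγ : γ = x ^ 2 + (1 - x) * r) (hx0 : 0 < x) (hx1 : x < 1) (hr0 : 0 ≤ r)
    (hrx : r < x) (hcx : c < x) (ha0 : 0 < a) (hρP : ρP = c + r * a) (hρPx : x ≤ ρP) (hinc : a ≤ ρP)
    (hc₂ : c₂ = UL[x, c]) (hUH : UH = ρP / (1 - ρP)) :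
    (1 - γ) - (1 - γ) * c₂ / UH ≤ γ / (1 + x - c) := by
  have h := one_sub_heavy_le x r c a γ ρP c₂ UH hγ hx0 hx1 hrx hcx ha0 hρP hρPx hc₂ hUH
  have hρP0 : 0 < ρP := by linarith
  have hγ0 : 0 ≤ γ := by rw [hγ]; nlinarith
  have d1 : (0:ℝ) < 1 + x - c := by linarith
  have : γ * a / ((1 + x - c) * ρP) ≤ γ / (1 + x - c) := by
    rw [div_le_div_iff₀ (mul_pos d1 hρP0) d1]
    have := mul_le_mul_of_nonneg_left hinc hγ0
    nlinarith [mul_le_mul_of_nonneg_left this d1.le]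
  linarith

/-- (heavy `P2→PH`, compatible `P2→M2`, necessarily heavy) `R_C ≤ γ/(1+x−c)`. [this work] -/
theorem restC_hc (x r c a γ ρP c₂ UH UM : ℝ) (hγ : γ = x ^ 2 + (1 - x) * r) (hx0 : 0 < x) (hx1 : x < 1) (hr0 : 0 ≤ r)
    (hrx : r < x) (hcx : c < x) (ha0 : 0 < a) (hρP : ρP = c + r * a) (hρPx : x ≤ ρP) (hcomp : ρP < a)
    (hc₂ : c₂ = UL[x, c]) (hUH : UH = ρP / (1 - ρP)) (hUM : UM = (ρP / a) / (1 - ρP / a)) :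
    (1 - γ) - (1 - γ) * c₂ / UH - γ / UM ≤ γ / (1 + x - c) := by
  have h := one_sub_heavy_le x r c a γ ρP c₂ UH hγ hx0 hx1 hrx hcx ha0 hρP hρPx hc₂ hUH
  have hρP0 : 0 < ρP := by linarith
  have hγ0 : 0 ≤ γ := by rw [hγ]; nlinarith
  have d1 : (1:ℝ) ≤ 1 + x - c := by linarith
  have hUMv : γ / UM = γ * (a - ρP) / ρP := by rw [hUM]; field_simp
  rw [hUMv]
  -- `γ(a−ρP)/ρP ≥ γ(a−ρP)/((1+x−c)ρP)` and `γa/((1+x−c)ρP) − γ(a−ρP)/((1+x−c)ρP) = γ/(1+x−c)`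
  have s2 : γ * (a - ρP) / ((1 + x - c) * ρP) ≤ γ * (a - ρP) / ρP := by
    rw [show γ * (a - ρP) / ((1 + x - c) * ρP) = (γ * (a - ρP) / ρP) / (1 + x - c) by field_simp]
    exact div_le_self (div_nonneg (mul_nonneg hγ0 (by linarith)) hρP0.le) d1
  have s3 : γ * a / ((1 + x - c) * ρP) - γ * (a - ρP) / ((1 + x - c) * ρP) = γ / (1 + x - c) := by
    field_simp; ring
  linarith

/-- **`max(R_C, 0) ≤ γ/(1+x−c)`** — piece C leaves at most `γ m_C/(1+x−c)` of its low for the giants. [this work] -/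
theorem restC_le (x r c a γ ρP c₂ UH UM : ℝ) (cM : Prop) [Decidable cM] (hγ : γ = x ^ 2 + (1 - x) * r) (hx0 : 0 < x) (hx1 : x < 1)
    (hr0 : 0 ≤ r) (hrx : r < x) (hc0 : 0 ≤ c) (hcx : c < x) (ha0 : 0 < a) (ha1 : a ≤ 1) (hρP : ρP = c + r * a)
    (hc₂ : c₂ = UL[x, c]) (hUHl : ρP ≤ x → UH = UL[x, ρP]) (hUHh : x ≤ ρP → UH = ρP / (1 - ρP))
    (hcM : cM ↔ ρP < a) (hUMl : ρP / a ≤ x → ρP < a → UM = UL[x, ρP / a]) (hUMh : x ≤ ρP / a → ρP < a → UM = (ρP / a) / (1 - ρP / a)) :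
    max ((1 - γ) - (1 - γ) * c₂ / UH - (if cM then γ / UM else 0)) 0 ≤ γ / (1 + x - c) := by
  have hγ0 : 0 ≤ γ := by rw [hγ]; nlinarith
  have hpos : 0 ≤ γ / (1 + x - c) := div_nonneg hγ0 (by linarith)
  refine max_le ?_ hpos
  by_cases hc : cM
  · rw [if_pos hc]
    have hcomp : ρP < a := hcM.1 hc
    rcases le_or_gt ρP x with hl | hh
    · rcases le_or_gt (ρP / a) x with hσl | hσh
      · have := restC_llight_nonpos x r c a γ ρP c₂ UH UM hγ hx0 hx1 hr0 hc0 hcx ha0 ha1 hρP hl hσl hc₂ (hUHl hl) (hUMl hσl hcomp)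
        linarith
      · exact restC_lh x r c a γ ρP c₂ UH UM hγ hx0 hx1 hr0 hcx ha0 hρP hl hcomp hσh.le hc₂ (hUHl hl) (hUMh hσh.le hcomp)
    · have hσ : x ≤ ρP / a := by
        rw [le_div_iff₀ ha0]; nlinarith
      exact restC_hc x r c a γ ρP c₂ UH UM hγ hx0 hx1 hr0 hrx hcx ha0 hρP hh.le hcomp hc₂ (hUHh hh.le) (hUMh hσ hcomp)
  · rw [if_neg hc, sub_zero]
    have hinc : a ≤ ρP := by
      by_contra hlt; push Not at hlt; exact hc (hcM.2 hlt)
    rcases le_or_gt ρP x with hl | hh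
    · exact restC_ll x r c a γ ρP c₂ UH hγ hx0 hx1 hr0 hcx ha0 hρP hl hinc hc₂ (hUHl hl)
    · exact restC_hi x r c a γ ρP c₂ UH hγ hx0 hx1 hr0 hrx hcx ha0 hρP hh.le hinc hc₂ (hUHh hh.le)

/-- **`max(R_C, 0) + γ(x−c)θ/(1+x−c) ≤ γ` for the price factor `θ = a/(w + ra)` of a compatible (heavy) pair `P1 → M1`** of the
expensive piece (`w = ρ_e·ε ≥ x`, `w + ra < a`). [this work] -/
theorem restC_le_theta (x r c a γ ρP c₂ UH UM w : ℝ) (cM : Prop) [Decidable cM] (hγ : γ = x ^ 2 + (1 - x) * r) (hx0 : 0 < x)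
    (hx1 : x < 1) (hr0 : 0 ≤ r) (hrx : r < x) (hc0 : 0 ≤ c) (hcx : c < x) (ha0 : 0 < a) (ha1 : a ≤ 1) (hρP : ρP = c + r * a)
    (hc₂ : c₂ = UL[x, c]) (hUHl : ρP ≤ x → UH = UL[x, ρP]) (hUHh : x ≤ ρP → UH = ρP / (1 - ρP))
    (hcM : cM ↔ ρP < a) (hUMl : ρP / a ≤ x → ρP < a → UM = UL[x, ρP / a]) (hUMh : x ≤ ρP / a → ρP < a → UM = (ρP / a) / (1 - ρP / a))
    (hwx : x ≤ w) (hw1 : w + r * a < a) :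
    max ((1 - γ) - (1 - γ) * c₂ / UH - (if cM then γ / UM else 0)) 0 + γ * (x - c) * (a / (w + r * a)) / (1 + x - c) ≤ γ := by
  have hγ0 : 0 ≤ γ := by rw [hγ]; nlinarith
  have hra0 : 0 ≤ r * a := mul_nonneg hr0 ha0.le
  have hwra : 0 < w + r * a := by linarith
  have hxc1 : (0:ℝ) < 1 + x - c := by linarith
  have hcomp : ρP < a := by rw [hρP]; linarith
  have hc : cM := hcM.2 hcomp
  have hρPw : ρP ≤ w + r * a := by rw [hρP]; linarith
  -- the extra term alone is `≤ γ`
  have hextra : γ * (x - c) * (a / (w + r * a)) / (1 + x - c) ≤ γ := by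
    rw [div_le_iff₀ hxc1]
    have h1 : (x - c) * (a / (w + r * a)) ≤ 1 := by
      rw [← mul_div_assoc, div_le_one hwra]; nlinarith
    nlinarith [mul_le_mul_of_nonneg_left h1 hγ0]
  rw [if_pos hc]
  rcases le_or_gt ((1 - γ) - (1 - γ) * c₂ / UH - γ / UM) 0 with hR | hR
  · rw [max_eq_right hR]; linarith
  rw [max_eq_left hR.le]
  have hρP0 : 0 < ρP := by
    rcases le_or_gt ρP x with hl | hh
    · -- light `P2→PH`: `ρP/a ≤ x` would give `R ≤ 0`
      by_contra hle
      push Not at hle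
      have hρP00 : ρP = 0 := le_antisymm hle (by rw [hρP]; nlinarith)
      have hσl : ρP / a ≤ x := by rw [hρP00, zero_div]; exact hx0.le
      have := restC_llight_nonpos x r c a γ ρP c₂ UH UM hγ hx0 hx1 hr0 hc0 hcx ha0 ha1 hρP hl hσl hc₂ (hUHl hl) (hUMl hσl hcomp)
      linarith
    · linarith
  -- the extra term is at most `γ(x−c)a/((1+x−c)ρP)`
  have hextra2 : γ * (x - c) * (a / (w + r * a)) / (1 + x - c) ≤ γ * (x - c) * a / ((1 + x - c) * ρP) := by
    rw [div_le_div_iff₀ hxc1 (mul_pos hxc1 hρP0)]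
    have h1 : a / (w + r * a) ≤ a / ρP := div_le_div_of_nonneg_left ha0.le hρP0 hρPw
    have h2 : 0 ≤ γ * (x - c) := mul_nonneg hγ0 (by linarith)
    have h3 := mul_le_mul_of_nonneg_left h1 h2
    have h4 : γ * (x - c) * (a / ρP) * ((1 + x - c) * ρP) = γ * (x - c) * a * (1 + x - c) := by
      field_simp
    nlinarith [mul_le_mul_of_nonneg_right h3 (mul_pos hxc1 hρP0).le]
  have hσ_of : x ≤ ρP / a → γ / UM = γ * (a - ρP) / ρP := by
    intro hσ; rw [hUMh hσ hcomp]; field_simp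
  rcases le_or_gt ρP x with hl | hh
  · -- light `P2 → PH`
    rcases le_or_gt (ρP / a) x with hσl | hσh
    · have := restC_llight_nonpos x r c a γ ρP c₂ UH UM hγ hx0 hx1 hr0 hc0 hcx ha0 ha1 hρP hl hσl hc₂ (hUHl hl) (hUMl hσl hcomp)
      linarith
    have hfr := one_sub_light x r c a ρP c₂ UH hx0 hx1 hcx hρP hρP0.le hl hc₂ (hUHl hl)
    have e : (1 - γ) - (1 - γ) * c₂ / UH - γ / UM = (1 - γ) * (1 - c₂ / UH) - γ / UM := by ring
    rw [e, hfr, hσ_of hσh.le]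
    have gP0 : 0 < x ^ 2 + (1 - x) * ρP := by nlinarith
    have h1 := key_ra x r a γ hγ hx1 ha0.le
    -- `(1−γ)ra/(γP(1+x−c)) ≤ (γa/ρP)·((1−x)ρP/γP)/(1+x−c) ≤ ... `; we bound the two positive terms by `γ a/ρP`:
    have s1 : (1 - γ) * (r * a / ((x ^ 2 + (1 - x) * ρP) * (1 + x - c))) ≤ γ * a * (1 - x) / ((1 + x - c) * (x ^ 2 + (1 - x) * ρP)) := by
      rw [show (1 - γ) * (r * a / ((x ^ 2 + (1 - x) * ρP) * (1 + x - c)))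
          = (1 - γ) * (r * a) / ((1 + x - c) * (x ^ 2 + (1 - x) * ρP)) by field_simp]
      exact div_le_div_of_nonneg_right (by linarith) (mul_pos hxc1 gP0).le
    -- `γ a (1−x)/((1+x−c)γP) + γ(x−c)a/((1+x−c)ρP) ≤ γ a/ρP`  ⟸  `(1−x)ρP/γP + (x − c) ≤ 1 + x − c`  ⟸  `(1−x)ρP ≤ γP`
    have s2 : γ * a * (1 - x) / ((1 + x - c) * (x ^ 2 + (1 - x) * ρP)) + γ * (x - c) * a / ((1 + x - c) * ρP) ≤ γ * a / ρP := by
      have lhs_eq : γ * a * (1 - x) / ((1 + x - c) * (x ^ 2 + (1 - x) * ρP)) + γ * (x - c) * a / ((1 + x - c) * ρP)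
          = (γ * a / ρP) * (((1 - x) * ρP / (x ^ 2 + (1 - x) * ρP) + (x - c)) / (1 + x - c)) := by
        field_simp
      rw [lhs_eq]
      have t : ((1 - x) * ρP / (x ^ 2 + (1 - x) * ρP) + (x - c)) / (1 + x - c) ≤ 1 := by
        rw [div_le_one hxc1]
        have : (1 - x) * ρP / (x ^ 2 + (1 - x) * ρP) ≤ 1 := by
          rw [div_le_one gP0]; nlinarith
        linarith
      have g0 : 0 ≤ γ * a / ρP := div_nonneg (mul_nonneg hγ0 ha0.le) hρP0.le
      nlinarith [mul_le_mul_of_nonneg_left t g0]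
    have s3 : γ * a / ρP - γ * (a - ρP) / ρP = γ := by field_simp; ring
    linarith [s1, s2, s3, hextra2]
  · -- heavy `P2 → PH`
    have hσ : x ≤ ρP / a := by rw [le_div_iff₀ ha0]; nlinarith
    have h := one_sub_heavy_le x r c a γ ρP c₂ UH hγ hx0 hx1 hrx hcx ha0 hρP hh.le hc₂ (hUHh hh.le)
    rw [hσ_of hσ]
    have s3 : γ * a / ((1 + x - c) * ρP) + γ * (x - c) * a / ((1 + x - c) * ρP) - γ * (a - ρP) / ρP = γ := by
      field_simp; ring
    linarith [hextra2]

end WideCell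

end LawDec

end Quant

end Summit.CriticalPhenomena.PercolationContinuityZ3.Theorems
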